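import Summits.CriticalPhenomena.PercolationContinuityZ3.Theorems.Transplant.SharpnessUnitCylinderWitness
import Summits.CriticalPhenomena.PercolationContinuityZ3.Theorems.Transplant.CayleyNilpotentFrmFrom
import HarnessLib

/-!
# The (κ′)-genuine witness `Q = ℤ⁴ ⋊_J ℤ` IS a member of the lane's flagship U-customer family `NilFrm.Data` (letters-type nilpotent, ANY class):
# `Q` is nilpotent of class EXACTLY 4 (`lowerCentralSeries 4 = ⊥`, `(e₃,0) ∈ lowerCentralSeries 3 ≠ ⊥`), so the RULING A-U-VAC witness has the ruling's literal shape —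
# "a class-4 letters-type nilpotent Cayley graph with ℓ₀ > 1 forced" — entirely in the kernel

builds on p205010 (kernel theorem, internal audit signed; external expert review pending) — nothing here uses p205010; NOTHING is claimed about any open node (`θ(p_c) = 0` on
`Cay(Q; a^{±1}, b^{±1})` stays MODULO the open node U: `Filiform.nilData.criticalContinuity_of_frmFromNode₁`).
Lane `prim-bschramm`, seat `prim-bschramm-p5` gen 24 (refuter; P5-SHARPNESS §54.12; class B, companion of «SharpnessUnitCylinderWitness» p443439).  Helper file
(`--supports stmt-CriticalPhenomena-4575 --as helper`).
* §1 `conj_lat'` (conjugating a lattice element by ANY `x` applies `J^{x.right}`), `comm_lat'` (`⁅(v,0), x⁆ = (v − J^{x.right} v, 0)`), the FLAG `(∀ jj : Fin 4, jj < i → v jj = 0)` (`v_j = 0` for `j < i`) is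
  preserved by every power of `J`, which acts as the identity on the `i`-th coordinate modulo the flag (`toAdd_act_flag`).
* §2 `L n` = the lattice elements with `v_j = 0` for `j < n` (`n ≥ 1`), a subgroup; **`lowerCentralSeries_succ_le_L`**: `γ_{n+1}(Q) ≤ L (n+1)`… precisely
  `(⊤).lowerCentralSeries (n + 1) ≤ L (n + 1)` for all `n` (base: the chart `φ` is additive so every commutator has `φ = 0`; step: `comm_lat'` + the flag);
  **`lowerCentralSeries_four_eq_bot`** (`L 4 = ⊥`); `lat_e_mem_lowerCentralSeries` (`(eₙ,0) ∈ γ… n`) and **`lowerCentralSeries_three_ne_bot`**: class EXACTLY 4.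
* §3 **`Filiform.nilData : NilFrm.Data Q`** (alphabet `S`, `c := 3`, chart `φ`, unit steps `a ↦ e₀`, `b ↦ e₁`) and its conditional continuity through U — so `Q` sits in the
  family of CayleyNilpotentFrmFrom :163 (`NilFrm.Data.criticalContinuity_of_frmFromNode₁`), with (κ) FAILING at width 1 by `Filiform.not_connected_unitCyl`.
[cite: BenjaminiSchramm1996, Conj. 4; §2 (Cayley graphs)] [cite: KozmaNitzan2024, §4 p. 16 (Lemma 8)]
-/

noncomputable section

namespace Summit.CriticalPhenomena.PercolationContinuityZ3.Theorems.Transplant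

open SimpleGraph Literature.Probability.LatticeModels Literature.Probability.Percolation Multiplicative
open scoped commutatorElement

namespace Filiform

/-! ## §1 Conjugation by an arbitrary element; the flag -/

/-- **Conjugating a lattice element by any `x` applies `J^{x.right}`** (the lattice is abelian, so `x.left` cancels). [folklore] -/
theorem conj_lat' (x : Q) (n : Lat) : x * SemidirectProduct.inl n * x⁻¹ = SemidirectProduct.inl (act x.right n) := by
  refine SemidirectProduct.ext ?_ ?_
  · have hcancel : act x.right (act x.right⁻¹ x.left⁻¹) = x.left⁻¹ := by
      rw [← MulAut.mul_apply, ← map_mul, mul_inv_cancel, map_one, MulAut.one_apply]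
    apply toAdd.injective
    funext i
    simp only [SemidirectProduct.mul_left, SemidirectProduct.mul_right, SemidirectProduct.left_inl, SemidirectProduct.right_inl,
      SemidirectProduct.inv_left, mul_one, hcancel, toAdd_mul, toAdd_inv, Pi.add_apply, Pi.neg_apply]
    ring
  · simp [SemidirectProduct.mul_right, SemidirectProduct.inv_right]

/-- **The commutator of a lattice element with any `x`**: `⁅inl n, x⁆ = inl (n · (J^{x.right} n)⁻¹)`. [folklore] -/
theorem comm_lat' (n : Lat) (x : Q) : ⁅(SemidirectProduct.inl n : Q), x⁆ = SemidirectProduct.inl (n * (act x.right n)⁻¹) := by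
  rw [commutatorElement_def, map_mul, map_inv, ← conj_lat' x n]
  group

/-- `J` preserves the flag and is the identity on the `i`-th coordinate modulo it. [folklore] -/
theorem flag_jmap {i : Fin 4} {v : Fin 4 → ℤ} (h : (∀ jj : Fin 4, jj < i → v jj = 0)) : (∀ jj : Fin 4, jj < i → (jmap v) jj = 0) ∧ jmap v i = v i := by
  constructor
  · intro j hj
    have hv := h j hj
    fin_cases j <;> fin_cases i <;> simp [jmap] at hj hv ⊢ <;> simp_all
  · fin_cases i
    · simp [jmap]
    · have := h 0 (by decide); simp [jmap, this]
    · have := h 1 (by decide); simp [jmap, this]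
    · have := h 2 (by decide); simp [jmap, this]

/-- `J⁻¹` preserves the flag and is the identity on the `i`-th coordinate modulo it. [folklore] -/
theorem flag_jinv {i : Fin 4} {v : Fin 4 → ℤ} (h : (∀ jj : Fin 4, jj < i → v jj = 0)) : (∀ jj : Fin 4, jj < i → (jinv v) jj = 0) ∧ jinv v i = v i := by
  constructor
  · intro j hj
    have hv := h j hj
    fin_cases j <;> fin_cases i <;> simp [jinv] at hj hv ⊢ <;> simp_all
  · fin_cases i
    · simp [jinv]
    · have := h 0 (by decide); simp [jinv, this]
    · have h0 := h 0 (by decide); have h1 := h 1 (by decide); simp [jinv, h0, h1]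
    · have h0 := h 0 (by decide); have h1 := h 1 (by decide); have h2 := h 2 (by decide); simp [jinv, h0, h1, h2]

/-- `J` on an explicit vector. [folklore] -/
theorem J_ofAdd (v : Fin 4 → ℤ) : J (ofAdd v) = ofAdd (jmap v) := rfl

/-- `J⁻¹` on an explicit vector. [folklore] -/
theorem J_symm_ofAdd (v : Fin 4 → ℤ) : J.symm (ofAdd v) = ofAdd (jinv v) := rfl

/-- **Every power of `J` preserves the flag and fixes the `i`-th coordinate modulo it.** [folklore] -/
theorem toAdd_zpow_J_flag (l : ℤ) {i : Fin 4} : ∀ {v : Fin 4 → ℤ}, (∀ jj : Fin 4, jj < i → v jj = 0) →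
    (∀ jj : Fin 4, jj < i → (toAdd ((J ^ l) (ofAdd v))) jj = 0) ∧ toAdd ((J ^ l) (ofAdd v)) i = v i := by
  induction l using Int.induction_on with
  | zero => intro v h; simpa using h
  | succ k ih =>
    intro v h
    rw [zpow_add_one, MulAut.mul_apply, J_ofAdd]
    obtain ⟨hf, he⟩ := ih (flag_jmap h).1
    exact ⟨hf, he.trans (flag_jmap h).2⟩
  | pred k ih =>
    intro v h
    rw [zpow_sub_one, MulAut.mul_apply, MulAut.inv_apply, J_symm_ofAdd]
    obtain ⟨hf, he⟩ := ih (flag_jinv h).1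
    exact ⟨hf, he.trans (flag_jinv h).2⟩

/-- The same for the action `act g = J^{g}`. [folklore] -/
theorem toAdd_act_flag (g : Rot) {i : Fin 4} {v : Fin 4 → ℤ} (h : (∀ jj : Fin 4, jj < i → v jj = 0)) :
    (∀ jj : Fin 4, jj < i → (toAdd (act g (ofAdd v))) jj = 0) ∧ toAdd (act g (ofAdd v)) i = v i := by
  rw [act_apply]; exact toAdd_zpow_J_flag (toAdd g) h

/-! ## §2 The flag subgroups bound the lower central series: class exactly 4 -/

/-- **The flag subgroup `L n`**: lattice elements (`k = 0`) whose coordinates below `n` vanish. [folklore] -/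
def L (n : Fin 4) : Subgroup Q where
  carrier := {x | toAdd x.right = 0 ∧ (∀ jj : Fin 4, jj < n → (toAdd x.left) jj = 0)}
  mul_mem' := by
    rintro x y ⟨hx0, hx⟩ ⟨hy0, hy⟩
    have hxr : x.right = 1 := by rw [← ofAdd_toAdd x.right, hx0]; rfl
    refine ⟨by rw [SemidirectProduct.mul_right, toAdd_mul, hx0, hy0, add_zero], fun j hj => ?_⟩
    rw [SemidirectProduct.mul_left, hxr, map_one, MulAut.one_apply, toAdd_mul, Pi.add_apply, hx j hj, hy j hj, add_zero]
  one_mem' := ⟨by simp, fun j _ => by simp⟩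
  inv_mem' := by
    rintro x ⟨hx0, hx⟩
    have hxr : x.right = 1 := by rw [← ofAdd_toAdd x.right, hx0]; rfl
    refine ⟨by rw [SemidirectProduct.inv_right, toAdd_inv, hx0, neg_zero], fun j hj => ?_⟩
    rw [SemidirectProduct.inv_left, hxr, inv_one, map_one, MulAut.one_apply, toAdd_inv, Pi.neg_apply, hx j hj, neg_zero]

/-- Membership in `L n`. [folklore] -/
theorem mem_L {n : Fin 4} {x : Q} : x ∈ L n ↔ toAdd x.right = 0 ∧ (∀ jj : Fin 4, jj < n → (toAdd x.left) jj = 0) := Iff.rfl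

/-- An element of `L n` is the lattice element of its left part. [folklore] -/
theorem eq_inl_of_mem_L {n : Fin 4} {x : Q} (hx : x ∈ L n) : x = SemidirectProduct.inl x.left := by
  have hxr : x.right = 1 := by rw [← ofAdd_toAdd x.right, hx.1]; rfl
  refine SemidirectProduct.ext ?_ ?_
  · simp
  · simp [hxr]

/-- **Base**: every commutator lies in `L 1` — the chart `φ = (k, v₀)` is additive, so it kills commutators. [folklore] -/
theorem commutator_mem_L_one (x y : Q) : ⁅x, y⁆ ∈ L 1 := by
  have hφ : φ ⁅x, y⁆ = 0 := by
    rw [commutatorElement_def, φ_mul, φ_mul, φ_mul, φ_inv, φ_inv]; abel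
  refine ⟨by simpa using congrFun hφ 0, fun j hj => ?_⟩
  have hj0 : j = 0 := by fin_cases j <;> simp_all
  subst hj0
  simpa using congrFun hφ 1

/-- **Step**: the commutator of an element of `L n` with anything lies in `L (n+1)` (`n < 3`): it is `(v − J^l v, 0)` and `J^l` fixes `vₙ` modulo the flag. [folklore] -/
theorem commutator_mem_L_succ {n : Fin 4} (hn : n ≠ 3) {x : Q} (hx : x ∈ L n) (y : Q) : ⁅x, y⁆ ∈ L (n + 1) := by
  rw [eq_inl_of_mem_L hx, comm_lat']
  refine ⟨by simp, fun j hj => ?_⟩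
  simp only [SemidirectProduct.left_inl, toAdd_mul, toAdd_inv, Pi.add_apply, Pi.neg_apply]
  have hflag := hx.2
  -- `j < n + 1` means `j ≤ n`: either `j < n` (flag) or `j = n` (fixed coordinate)
  by_cases hjn : j < n
  · have hflag' : (∀ jj : Fin 4, jj < j → (toAdd x.left) jj = 0) := fun i hi => hflag i (lt_trans hi hjn)
    have h := toAdd_act_flag y.right hflag'
    rw [ofAdd_toAdd] at h
    rw [hflag j hjn, h.2, hflag j hjn, neg_zero, add_zero]
  · have hjn' : j = n := by
      fin_cases n <;> fin_cases j <;> simp_all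
    subst hjn'
    have h := toAdd_act_flag y.right hflag
    rw [ofAdd_toAdd] at h
    rw [h.2, add_neg_cancel]

/-- **`γ_{n+1}(Q) ≤ L (n+1)`** along the flag: `(⊤).lowerCentralSeries 1 ≤ L 1`, `… 2 ≤ L 2`, `… 3 ≤ L 3`. [folklore] -/
theorem lowerCentralSeries_le_L :
    (⊤ : Subgroup Q).lowerCentralSeries 1 ≤ L 1 ∧ (⊤ : Subgroup Q).lowerCentralSeries 2 ≤ L 2 ∧ (⊤ : Subgroup Q).lowerCentralSeries 3 ≤ L 3 := by
  have h1 : (⊤ : Subgroup Q).lowerCentralSeries 1 ≤ L 1 := by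
    rw [Subgroup.lowerCentralSeries_succ, Subgroup.lowerCentralSeries_zero, Subgroup.commutator_le]
    exact fun x _ y _ => commutator_mem_L_one x y
  have h2 : (⊤ : Subgroup Q).lowerCentralSeries 2 ≤ L 2 := by
    rw [Subgroup.lowerCentralSeries_succ, Subgroup.commutator_le]
    exact fun x hx y _ => commutator_mem_L_succ (n := 1) (by decide) (h1 hx) y
  have h3 : (⊤ : Subgroup Q).lowerCentralSeries 3 ≤ L 3 := by
    rw [Subgroup.lowerCentralSeries_succ, Subgroup.commutator_le]
    exact fun x hx y _ => commutator_mem_L_succ (n := 2) (by decide) (h2 hx) y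
  exact ⟨h1, h2, h3⟩

/-- **`Q` IS NILPOTENT OF CLASS ≤ 4**: `(⊤).lowerCentralSeries 4 = ⊥` (a commutator of an `L 3` element with anything is `(v − J^l v, 0)` with `v = v₃ e₃` fixed by `J^l`). [folklore] -/
theorem lowerCentralSeries_four_eq_bot : (⊤ : Subgroup Q).lowerCentralSeries 4 = ⊥ := by
  rw [eq_bot_iff, Subgroup.lowerCentralSeries_succ, Subgroup.commutator_le]
  intro x hx y _
  have hx3 := lowerCentralSeries_le_L.2.2 hx
  rw [Subgroup.mem_bot, eq_inl_of_mem_L hx3, comm_lat']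
  have hflag := hx3.2
  have key : x.left * (act y.right x.left)⁻¹ = 1 := by
    apply toAdd.injective
    funext j
    rw [toAdd_mul, toAdd_inv, toAdd_one, Pi.add_apply, Pi.neg_apply, Pi.zero_apply]
    by_cases hj : j < 3
    · have hflag' : (∀ jj : Fin 4, jj < j → (toAdd x.left) jj = 0) := fun i hi => hflag i (lt_trans hi hj)
      have h := toAdd_act_flag y.right hflag'
      rw [ofAdd_toAdd] at h
      rw [hflag j hj, h.2, hflag j hj, neg_zero, add_zero]
    · have hj3 : j = 3 := by fin_cases j <;> simp_all
      subst hj3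
      have h := toAdd_act_flag y.right hflag
      rw [ofAdd_toAdd] at h
      rw [h.2, add_neg_cancel]
  rw [key, map_one]

/-- `(eₙ, 0) ∈ γₙ(Q)`-type memberships up the flag: `(e₁,0) ∈ γ… 1`, `(e₂,0) ∈ … 2`, `(e₃,0) ∈ … 3` (iterated commutators with `a`). [folklore] -/
theorem lat_e_mem_lowerCentralSeries :
    lat (e 1) ∈ (⊤ : Subgroup Q).lowerCentralSeries 1 ∧ lat (e 2) ∈ (⊤ : Subgroup Q).lowerCentralSeries 2 ∧
      lat (e 3) ∈ (⊤ : Subgroup Q).lowerCentralSeries 3 := by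
  -- `⁅a, (eᵢ,0)⁆ = (eᵢ₊₁, 0)` and `⁅(eᵢ,0), a⁆ = its inverse`
  have hc : ∀ i : Fin 4, i ≠ 3 → ⁅lat (e i), a⁆ = (lat (e (i + 1)))⁻¹ := by
    intro i hi
    rw [← commutatorElement_inv, commutatorElement_def, comm_lat, jmap_e_sub i hi]
  have hmem : ∀ i : Fin 4, i ≠ 3 → ∀ H : Subgroup Q, lat (e i) ∈ H → lat (e (i + 1)) ∈ ⁅H, (⊤ : Subgroup Q)⁆ := by
    intro i hi H h
    have h' := Subgroup.commutator_mem_commutator h (Subgroup.mem_top a)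
    rw [hc i hi] at h'
    exact (Subgroup.inv_mem_iff _).1 h'
  have h1 : lat (e 1) ∈ (⊤ : Subgroup Q).lowerCentralSeries 1 := by
    rw [Subgroup.lowerCentralSeries_succ, Subgroup.lowerCentralSeries_zero]
    exact hmem 0 (by decide) ⊤ (Subgroup.mem_top _)
  have h2 : lat (e 2) ∈ (⊤ : Subgroup Q).lowerCentralSeries 2 := by
    rw [Subgroup.lowerCentralSeries_succ]; exact hmem 1 (by decide) _ h1
  have h3 : lat (e 3) ∈ (⊤ : Subgroup Q).lowerCentralSeries 3 := by
    rw [Subgroup.lowerCentralSeries_succ]; exact hmem 2 (by decide) _ h2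
  exact ⟨h1, h2, h3⟩

/-- **Class EXACTLY 4**: `(⊤).lowerCentralSeries 3 ≠ ⊥` (it contains `(e₃, 0) ≠ 1`). [folklore] -/
theorem lowerCentralSeries_three_ne_bot : (⊤ : Subgroup Q).lowerCentralSeries 3 ≠ ⊥ := by
  intro h
  have h3 := lat_e_mem_lowerCentralSeries.2.2
  rw [h, Subgroup.mem_bot] at h3
  have h4 : toAdd (lat (e 3)).left 3 = toAdd (1 : Q).left 3 := by rw [h3]
  simp [lat, e] at h4

/-! ## §3 `Q` in the lane's nilpotent U-customer family -/

/-- `S` is symmetric. [folklore] -/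
theorem S_symm : ∀ s ∈ S, s⁻¹ ∈ S := by
  intro s hs
  simp only [S, Finset.mem_insert, Finset.mem_singleton] at hs ⊢
  rcases hs with rfl | rfl | rfl | rfl <;> simp

/-- **`Q` WITH ITS LETTERS ALPHABET IS A `NilFrm.Data`** (CayleyNilpotentFrmFrom §2: finitely generated nilpotent of class `≤ c + 1 = 4`, unit-range rank-2 chart with unit steps, NO
symmetry) — the RULING A-U-VAC witness in the ruling's literal shape. [cite: BenjaminiSchramm1996, §2 (Cayley graphs)] [cite: KozmaNitzan2024, §4 p. 16 (Lemma 8)] -/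
def nilData : NilFrm.Data Q where
  A := S
  symm := S_symm
  gen := closure_S
  c := 3
  nil := lowerCentralSeries_four_eq_bot
  φ := φ
  map_mul := φ_mul
  x := a
  x_mem := by simp [S]
  φ_x := φ_a
  y := b
  y_mem := by simp [S]
  φ_y := φ_b
  lip := lip

/-- The alphabet of `nilData` is `S`. [folklore] -/
@[simp] theorem nilData_A : nilData.A = S := rfl

/-- **`θ_g(p_c) = 0` on `Cay(Q; S)` through the nilpotent-family customer theorem, MODULO the open node U** (same statement as `criticalContinuity_of_frmFromNode₁`, reached through
`NilFrm.Data`; nothing unconditional claimed). [cite: BenjaminiSchramm1996, Conj. 4] -/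
theorem nilData_criticalContinuity_of_frmFromNode₁ (hN : SamePDropOfSkeletonFrmFrom₁) (g : Q) :
    theta (mulCayley (↑S : Set Q)) g (criticalProbIOf (mulCayley (↑S : Set Q)) g) = 0 :=
  nilData.criticalContinuity_of_frmFromNode₁ hN g

end Filiform

end Summit.CriticalPhenomena.PercolationContinuityZ3.Theorems.Transplant

end
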